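import Summits.CriticalPhenomena.CardyFormulaZ2.Theorems.CardyBoundaryCoulombGasBoundaryDefectGaussianRS17ConfigsNonemptyPart9

/-!
# Stub `s17_eventually_configsNonempty` of the D2 completion (line
# `rainbow-monomials-in-excursion-kernels`, crux `BoundaryDefectGaussianR`,
# stmt-CriticalPhenomena-14132) — Part 10: the levels of the strip cells near a flat insertion
# point, read off the straight run of the cycle

Setting of Part 9: `ι` admissible on `V`, `ds = cycle V d₀` from the sink's dart (length `P`),
`st t` the walk states, and a cycle dart `ds[s₀] = (x₀, k₀)` at an insertion point where `V` is
FLAT at radius `R ≥ 4`. Write `W = R - 2`, `τ = dir (k₀ + 1)`, `n = dir k₀`. By Part 8 (`ca_run`)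
the cycle runs straight through `x₀`: with the base index `B = s₀ + P W - W`,

  `ds[(B + e) % P] = (x₀ + (e - W) • τ, k₀)`  for `0 ≤ e ≤ 2 W`  (`cs_run`),

so column `a = e - W` of the strip is dart `(B + e) % P` of the cycle. The cells of the strip read
their prescribed levels at that dart (Part 43's `strip_*` lemmas, whose straight-strip hypotheses
hold by flatness, `cs_strip_mem`):
* `cs_face_level` — a prescribed wall face `gapFace (x₀ + a • τ, k₀)` is met on a FREE stretch and
  carries the level after its dart;
* `cs_vertex_level`, `cs_ghost_level` — a prescribed wall vertex `x₀ + a • τ` (an arc vertex) or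
  ghost `x₀ + a • τ + n` touches a WIRED stretch at its dart and carries the wired level there.
Registered one-line form `s17_configsNonempty_part10` (= `cs_run`). All [folklore].
-/

namespace Summit.CriticalPhenomena.CardyFormulaZ2.Cruxes.BoundaryDefectGaussianR.RainbowMonomialsInExcursionKernels

open Literature.Probability.LatticeModels Literature.Probability.LatticeModels.CollarLegModel

section Strip

variable (ι : LegInsertionData) (V : Finset (ℤ × ℤ)) {d₀ : Dart} (hadm : ι.IsAdmissible V)
  (h0 : outDart V ι.sink = some d₀) {st : ℕ → WalkState}
  (hst : ∀ t, st t = List.foldl (fun s d => s.step (ι.startAt V d)) ι.init ((cycle V d₀).take t))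
  (hchart : ∀ u ∈ V, ∀ k : Fin 4, u + dir k ∉ V → ∃ (K : Fin 4) (c₁ c₂ : ℤ),
    (∀ v : ℤ × ℤ, |v.1 - u.1| ≤ 3 → |v.2 - u.2| ≤ 3 →
      (v ∈ V ↔ c₂ ≤ v.1 * (dir (K + 1)).1 + v.2 * (dir (K + 1)).2)) ∨
    (∀ v : ℤ × ℤ, |v.1 - u.1| ≤ 3 → |v.2 - u.2| ≤ 3 →
      (v ∈ V ↔ c₁ ≤ v.1 * (dir K).1 + v.2 * (dir K).2 ∧
        c₂ ≤ v.1 * (dir (K + 1)).1 + v.2 * (dir (K + 1)).2)) ∨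
    (∀ v : ℤ × ℤ, |v.1 - u.1| ≤ 3 → |v.2 - u.2| ≤ 3 →
      (v ∈ V ↔ c₂ ≤ v.1 * (dir (K + 1)).1 + v.2 * (dir (K + 1)).2 ∨
        v.1 * (dir K).1 + v.2 * (dir K).2 ≤ c₁)))
  {s₀ : ℕ} (hs₀ : s₀ < (cycle V d₀).length) {x₀ : ℤ × ℤ} {k₀ : Fin 4}
  (hds₀ : (cycle V d₀)[s₀] = (x₀, k₀)) {dvec : ℤ × ℤ} {R : ℤ}
  (hd : dvec = (1, 0) ∨ dvec = (-1, 0) ∨ dvec = (0, 1) ∨ dvec = (0, -1))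
  (hflat : ∀ v : ℤ × ℤ, (v.1 - x₀.1) ^ 2 + (v.2 - x₀.2) ^ 2 ≤ R ^ 2 →
    (v ∈ V ↔ 0 ≤ (v.1 - x₀.1) * dvec.1 + (v.2 - x₀.2) * dvec.2)) (hR : 4 ≤ R)

include hadm h0 hds₀ hd hflat hR in
/-- **The straight run, indexed from its start.** With `W = R - 2` and base index
`B = s₀ + P W - W`: `ds[(B + e) % P] = (x₀ + (e - W) • dir (k₀+1), k₀)` for `e ≤ 2 W`. [folklore] -/
theorem cs_run (e : ℕ) (he : e ≤ 2 * (R - 2).toNat) :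
    (cycle V d₀)[(s₀ + (cycle V d₀).length * (R - 2).toNat - (R - 2).toNat + e) %
      (cycle V d₀).length]'(Nat.mod_lt _ (by omega)) =
      (x₀ + ((e : ℤ) - (R - 2).toNat) • dir (k₀ + 1), k₀) := by
  obtain ⟨hv₀, ht₀⟩ := sinkDart_exterior ι V hadm h0
  set P := (cycle V d₀).length with hPdef
  have hP : 0 < P := by omega
  set W := (R - 2).toNat with hWdef
  have hWR : (W : ℤ) = R - 2 := by rw [hWdef]; omega
  have hPW : W ≤ P * W := Nat.le_mul_of_pos_left W hP
  obtain ⟨hfwd, hbwd⟩ := ca_run hv₀ ht₀ hs₀ hds₀ hd hflat (by omega)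
  rcases le_or_gt e W with h | h
  · have hidx : s₀ + P * W - W + e = s₀ + P * W - (W - e) := by omega
    rw [getElem_cycle_congr (Nat.mod_lt _ hP) (Nat.mod_lt _ hP) (congrArg (· % P) hidx),
      hbwd (W - e) (by push_cast [Nat.cast_sub h]; omega)]
    refine Prod.ext ?_ rfl
    simp only
    rw [Nat.cast_sub h, sub_eq_add_neg x₀, ← neg_smul]
    congr 1
    ring_nf
  · have hidx : (s₀ + P * W - W + e) % P = (s₀ + (e - W)) % P := by
      rw [show s₀ + P * W - W + e = s₀ + (e - W) + P * W by omega, Nat.add_mul_mod_self_left]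
    rw [getElem_cycle_congr (Nat.mod_lt _ hP) (Nat.mod_lt _ hP) hidx,
      hfwd (e - W) (by push_cast [Nat.cast_sub h.le]; omega)]
    refine Prod.ext ?_ rfl
    simp only
    rw [Nat.cast_sub h.le]

include hd hflat hR in
/-- **The strip memberships around a wall dart.** For column `a` with `(|a| + 2)² + 4 ≤ R²` and the
wall vertex `z = x₀ + a • dir (k₀+1)`: the rows `0`, `-1` behind the wall are in `V`, the rows `1`,
`2` in front of it are not (columns `a - 1`, `a`, `a + 1`). [folklore] -/
theorem cs_strip_mem (hk₀ : x₀ + dir k₀ ∉ V) (a : ℤ) (ha : (|a| + 2) ^ 2 + 4 ≤ R ^ 2) :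
    x₀ + a • dir (k₀ + 1) ∈ V ∧ x₀ + a • dir (k₀ + 1) - dir (k₀ + 1) ∈ V ∧
    x₀ + a • dir (k₀ + 1) + dir (k₀ + 1) ∈ V ∧ x₀ + a • dir (k₀ + 1) - dir k₀ ∈ V ∧
    x₀ + a • dir (k₀ + 1) + dir k₀ ∉ V ∧ x₀ + a • dir (k₀ + 1) - dir (k₀ + 1) + dir k₀ ∉ V ∧
    x₀ + a • dir (k₀ + 1) + dir (k₀ + 1) + dir k₀ ∉ V ∧ x₀ + a • dir (k₀ + 1) + dir k₀ + dir k₀ ∉ V ∧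
    x₀ + a • dir (k₀ + 1) - dir (k₀ + 1) + dir k₀ + dir k₀ ∉ V ∧
    x₀ + a • dir (k₀ + 1) + dir (k₀ + 1) + dir k₀ + dir k₀ ∉ V ∧
    x₀ + a • dir (k₀ + 1) + dir (k₀ + 1) + dir (k₀ + 1) ∈ V ∧
    x₀ + a • dir (k₀ + 1) + dir (k₀ + 1) - dir k₀ ∈ V ∧
    x₀ + a • dir (k₀ + 1) + dir (k₀ + 1) + dir (k₀ + 1) + dir k₀ ∉ V ∧
    x₀ + a • dir (k₀ + 1) + dir (k₀ + 1) + dir (k₀ + 1) + dir k₀ + dir k₀ ∉ V := by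
  have habs := abs_nonneg a
  have hF := fun (b j : ℤ) (hbj : b ^ 2 + j ^ 2 ≤ R ^ 2) => flat_frame hd hflat (by omega) hk₀ b j hbj
  have bound : ∀ α β : ℤ, -1 ≤ α → α ≤ 2 → -1 ≤ β → β ≤ 2 → β ^ 2 + (a + α) ^ 2 ≤ R ^ 2 := by
    intro α β h1 h2 h3 h4
    have hle := le_abs_self a
    have hge := neg_abs_le a
    nlinarith
  have IN : ∀ α β : ℤ, -1 ≤ α → α ≤ 2 → -1 ≤ β → β ≤ 0 →
      x₀ + (a + α) • dir (k₀ + 1) + β • dir k₀ ∈ V := fun α β h1 h2 h3 h4 =>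
    (hF β (a + α) (bound α β h1 h2 h3 (by omega))).2 h4
  have OUT : ∀ α β : ℤ, -1 ≤ α → α ≤ 2 → 1 ≤ β → β ≤ 2 →
      x₀ + (a + α) • dir (k₀ + 1) + β • dir k₀ ∉ V := fun α β h1 h2 h3 h4 h =>
    absurd ((hF β (a + α) (bound α β h1 h2 (by omega) h4)).1 h) (by omega)
  refine ⟨mem_of_eq (IN 0 0 (by norm_num) (by norm_num) (by norm_num) le_rfl) (by module),
    mem_of_eq (IN (-1) 0 le_rfl (by norm_num) (by norm_num) le_rfl) (by module),
    mem_of_eq (IN 1 0 (by norm_num) (by norm_num) (by norm_num) le_rfl) (by module),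
    mem_of_eq (IN 0 (-1) (by norm_num) (by norm_num) le_rfl (by norm_num)) (by module),
    nmem_of_eq (OUT 0 1 (by norm_num) (by norm_num) le_rfl (by norm_num)) (by module),
    nmem_of_eq (OUT (-1) 1 le_rfl (by norm_num) le_rfl (by norm_num)) (by module),
    nmem_of_eq (OUT 1 1 (by norm_num) (by norm_num) le_rfl (by norm_num)) (by module),
    nmem_of_eq (OUT 0 2 (by norm_num) (by norm_num) (by norm_num) le_rfl) (by module),
    nmem_of_eq (OUT (-1) 2 le_rfl (by norm_num) (by norm_num) le_rfl) (by module),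
    nmem_of_eq (OUT 1 2 (by norm_num) (by norm_num) (by norm_num) le_rfl) (by module),
    mem_of_eq (IN 2 0 (by norm_num) le_rfl (by norm_num) le_rfl) (by module),
    mem_of_eq (IN 1 (-1) (by norm_num) (by norm_num) le_rfl (by norm_num)) (by module),
    nmem_of_eq (OUT 2 1 (by norm_num) le_rfl le_rfl (by norm_num)) (by module),
    nmem_of_eq (OUT 2 2 (by norm_num) le_rfl (by norm_num) le_rfl) (by module)⟩

include hadm h0 hst hchart hds₀ hd hflat hR in
/-- **The level of a prescribed wall face.** If column `a = e - W` (`1 ≤ e`, `e + 1 ≤ 2 W`) carries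
a NON-FREE gap face `gapFace (x₀ + a • dir (k₀+1), k₀)`, then the stretch after its dart
`c = (B + e) % P` is free and the face carries the level after that dart. [folklore] -/
theorem cs_face_level (e : ℕ) (he1 : 1 ≤ e) (he2 : e + 1 ≤ 2 * (R - 2).toNat)
    (hff : (gapFace (x₀ + ((e : ℤ) - (R - 2).toNat) • dir (k₀ + 1), k₀), true) ∉ (ι.model V).freeCells) :
    (st ((s₀ + (cycle V d₀).length * (R - 2).toNat - (R - 2).toNat + e) % (cycle V d₀).length + 1)).wired
        = false ∧
      (ι.model V).C.faceH (gapFace (x₀ + ((e : ℤ) - (R - 2).toNat) • dir (k₀ + 1), k₀)) =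
        (st ((s₀ + (cycle V d₀).length * (R - 2).toNat - (R - 2).toNat + e) %
          (cycle V d₀).length + 1)).level := by
  have hP : 0 < (cycle V d₀).length := by omega
  set a : ℤ := (e : ℤ) - (R - 2).toNat with hadef
  have hk₀ : x₀ + dir k₀ ∉ V := by
    have := (cycle_getElem_exterior ι V hadm h0 hs₀).2; rwa [hds₀] at this
  have hab : (|a| + 2) ^ 2 + 4 ≤ R ^ 2 := by
    have h1 : |a| ≤ R - 3 := by rw [hadef, abs_le]; constructor <;> omega
    nlinarith [abs_nonneg a]
  obtain ⟨-, -, mE, -⟩ := cs_strip_mem V hd hflat hR hk₀ a hab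
  have hc : (s₀ + (cycle V d₀).length * (R - 2).toNat - (R - 2).toNat + e) % (cycle V d₀).length <
      (cycle V d₀).length := Nat.mod_lt _ hP
  have hzc := cs_run ι V hadm h0 hs₀ hds₀ hd hflat hR e (by omega)
  rcases pc_face_touch ι V hadm h0 hst hchart hff with ⟨t, ht, hg, hw, hlev⟩ | ⟨-, hno⟩
  · obtain rfl := strip_index_of_gapFace ι V hadm h0 hc hzc mE ht hg
    exact ⟨hw, hlev⟩
  · exact absurd (by rw [hzc]) (hno _ hc)

include hadm h0 hst hds₀ hd hflat hR in
/-- **The level of a prescribed wall vertex.** If the wall vertex `z = x₀ + a • dir (k₀+1)` of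
column `a = e - W` (`1 ≤ e`, `e + 1 ≤ 2 W`) is NON-FREE (an arc vertex), then a wired stretch
touches its dart `c = (B + e) % P` and `vertH z` is the wired level there. [folklore] -/
theorem cs_vertex_level (e : ℕ) (he1 : 1 ≤ e) (he2 : e + 1 ≤ 2 * (R - 2).toNat)
    (hx : x₀ + ((e : ℤ) - (R - 2).toNat) • dir (k₀ + 1) ∈ (ι.model V).vertexCells)
    (hxf : (x₀ + ((e : ℤ) - (R - 2).toNat) • dir (k₀ + 1), false) ∉ (ι.model V).freeCells) :
    ((st ((s₀ + (cycle V d₀).length * (R - 2).toNat - (R - 2).toNat + e) % (cycle V d₀).length)).wired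
        = true ∨
      (st ((s₀ + (cycle V d₀).length * (R - 2).toNat - (R - 2).toNat + e) % (cycle V d₀).length
        + 1)).wired = true) ∧
    (ι.model V).C.vertH (x₀ + ((e : ℤ) - (R - 2).toNat) • dir (k₀ + 1)) =
      (if (st ((s₀ + (cycle V d₀).length * (R - 2).toNat - (R - 2).toNat + e) %
          (cycle V d₀).length)).wired = true
        then (st ((s₀ + (cycle V d₀).length * (R - 2).toNat - (R - 2).toNat + e) %
          (cycle V d₀).length)).level
        else (st ((s₀ + (cycle V d₀).length * (R - 2).toNat - (R - 2).toNat + e) %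
          (cycle V d₀).length + 1)).level) := by
  have hP : 0 < (cycle V d₀).length := by omega
  set a : ℤ := (e : ℤ) - (R - 2).toNat with hadef
  have hk₀ : x₀ + dir k₀ ∉ V := by
    have := (cycle_getElem_exterior ι V hadm h0 hs₀).2; rwa [hds₀] at this
  have hab : (|a| + 2) ^ 2 + 4 ≤ R ^ 2 := by
    have h1 : |a| ≤ R - 3 := by rw [hadef, abs_le]; constructor <;> omega
    nlinarith [abs_nonneg a]
  obtain ⟨m0, mW, mE, mS, -⟩ := cs_strip_mem V hd hflat hR hk₀ a hab
  have hc : (s₀ + (cycle V d₀).length * (R - 2).toNat - (R - 2).toNat + e) % (cycle V d₀).length <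
      (cycle V d₀).length := Nat.mod_lt _ hP
  have hzc := cs_run ι V hadm h0 hs₀ hds₀ hd hflat hR e (by omega)
  rcases mem_arc_or_ghosts_of_not_mem_freeCells (ι.model V) hx hxf with ⟨-, harc⟩ | ⟨hnV, -⟩
  · have hw := strip_arc_vertex ι V hadm h0 hst hc hzc mW mE mS harc
    exact ⟨hw, strip_vertH_vertex ι V hadm h0 hst hc hzc m0 mW mE mS hw⟩
  · exact absurd m0 hnV

include hadm h0 hst hds₀ hd hflat hR in
/-- **The level of a prescribed ghost above the wall.** If the ghost `z + dir k₀` above the wall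
vertex `z = x₀ + a • dir (k₀+1)` of column `a = e - W` (`1 ≤ e`, `e + 1 ≤ 2 W`) is a NON-FREE
vertex-cell, then a wired stretch touches the dart `c = (B + e) % P` below it and its `vertH` is
the wired level there. [folklore] -/
theorem cs_ghost_level (e : ℕ) (he1 : 1 ≤ e) (he2 : e + 1 ≤ 2 * (R - 2).toNat)
    (hx : x₀ + ((e : ℤ) - (R - 2).toNat) • dir (k₀ + 1) + dir k₀ ∈ (ι.model V).vertexCells)
    (hxf : (x₀ + ((e : ℤ) - (R - 2).toNat) • dir (k₀ + 1) + dir k₀, false) ∉ (ι.model V).freeCells) :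
    ((st ((s₀ + (cycle V d₀).length * (R - 2).toNat - (R - 2).toNat + e) % (cycle V d₀).length)).wired
        = true ∨
      (st ((s₀ + (cycle V d₀).length * (R - 2).toNat - (R - 2).toNat + e) % (cycle V d₀).length
        + 1)).wired = true) ∧
    (ι.model V).C.vertH (x₀ + ((e : ℤ) - (R - 2).toNat) • dir (k₀ + 1) + dir k₀) =
      (if (st ((s₀ + (cycle V d₀).length * (R - 2).toNat - (R - 2).toNat + e) %
          (cycle V d₀).length)).wired = true
        then (st ((s₀ + (cycle V d₀).length * (R - 2).toNat - (R - 2).toNat + e) %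
          (cycle V d₀).length)).level
        else (st ((s₀ + (cycle V d₀).length * (R - 2).toNat - (R - 2).toNat + e) %
          (cycle V d₀).length + 1)).level) := by
  have hP : 0 < (cycle V d₀).length := by omega
  set a : ℤ := (e : ℤ) - (R - 2).toNat with hadef
  have hk₀ : x₀ + dir k₀ ∉ V := by
    have := (cycle_getElem_exterior ι V hadm h0 hs₀).2; rwa [hds₀] at this
  have hab : (|a| + 2) ^ 2 + 4 ≤ R ^ 2 := by
    have h1 : |a| ≤ R - 3 := by rw [hadef, abs_le]; constructor <;> omega
    nlinarith [abs_nonneg a]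
  obtain ⟨m0, mW, mE, mS, nN, nNW, nNE, nNN, nNNW, nNNE, -⟩ := cs_strip_mem V hd hflat hR hk₀ a hab
  have hc : (s₀ + (cycle V d₀).length * (R - 2).toNat - (R - 2).toNat + e) % (cycle V d₀).length <
      (cycle V d₀).length := Nat.mod_lt _ hP
  have hcp : (s₀ + (cycle V d₀).length * (R - 2).toNat - (R - 2).toNat + (e - 1)) %
      (cycle V d₀).length < (cycle V d₀).length := Nat.mod_lt _ hP
  have hcp1 : ((s₀ + (cycle V d₀).length * (R - 2).toNat - (R - 2).toNat + (e - 1)) %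
      (cycle V d₀).length + 1) % (cycle V d₀).length =
      (s₀ + (cycle V d₀).length * (R - 2).toNat - (R - 2).toNat + e) % (cycle V d₀).length := by
    rw [Nat.mod_add_mod, show s₀ + (cycle V d₀).length * (R - 2).toNat - (R - 2).toNat + (e - 1) + 1 =
      s₀ + (cycle V d₀).length * (R - 2).toNat - (R - 2).toNat + e by omega]
  have hzc := cs_run ι V hadm h0 hs₀ hds₀ hd hflat hR e (by omega)
  have hzp : (cycle V d₀)[(s₀ + (cycle V d₀).length * (R - 2).toNat - (R - 2).toNat + (e - 1)) %
      (cycle V d₀).length]'hcp = (x₀ + a • dir (k₀ + 1) - dir (k₀ + 1), k₀) := by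
    rw [cs_run ι V hadm h0 hs₀ hds₀ hd hflat hR (e - 1) (by omega)]
    refine Prod.ext ?_ rfl
    simp only
    rw [Nat.cast_sub he1, hadef]
    module
  rcases mem_arc_or_ghosts_of_not_mem_freeCells (ι.model V) hx hxf with ⟨hV, -⟩ | ⟨-, hg⟩
  · exact absurd hV nN
  · have hw := strip_ghost ι V hadm h0 hst hc hzc hcp hcp1 hzp m0 mW mE mS nN nNW nNE nNN nNNW nNNE hg
    exact ⟨hw, strip_vertH_ghost ι V hadm h0 hst hc hzc hcp hcp1 hzp m0 mW mE mS nN nNW nNE nNN nNNW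
      nNNE hw⟩

end Strip

/-! ### Registered one-line form -/

/-- **Registered sub-goal `s17_configsNonempty_part10`** of `s17_eventually_configsNonempty`
(stmt-CriticalPhenomena-14132): the straight run of the boundary cycle through a flat insertion
point, indexed from its start (one-line form of `cs_run`). [folklore] -/
theorem s17_configsNonempty_part10 : ∀ (ι : Literature.Probability.LatticeModels.CollarLegModel.LegInsertionData) (V : Finset (ℤ × ℤ)) (d₀ : Literature.Probability.LatticeModels.CollarLegModel.Dart), ι.IsAdmissible V → Literature.Probability.LatticeModels.CollarLegModel.outDart V ι.sink = some d₀ → ∀ (s₀ : ℕ) (hs₀ : s₀ < (Literature.Probability.LatticeModels.CollarLegModel.cycle V d₀).length) (x₀ : ℤ × ℤ) (k₀ : Fin 4), (Literature.Probability.LatticeModels.CollarLegModel.cycle V d₀)[s₀] = (x₀, k₀) → ∀ (dvec : ℤ × ℤ) (R : ℤ), (dvec = (1, 0) ∨ dvec = (-1, 0) ∨ dvec = (0, 1) ∨ dvec = (0, -1)) → (∀ v : ℤ × ℤ, (v.1 - x₀.1) ^ 2 + (v.2 - x₀.2) ^ 2 ≤ R ^ 2 → (v ∈ V ↔ 0 ≤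 (v.1 - x₀.1) * dvec.1 + (v.2 - x₀.2) * dvec.2)) → 4 ≤ R → ∀ (e : ℕ) (he : e ≤ 2 * (R - 2).toNat), (Literature.Probability.LatticeModels.CollarLegModel.cycle V d₀)[(s₀ + (Literature.Probability.LatticeModels.CollarLegModel.cycle V d₀).length * (R - 2).toNat - (R - 2).toNat + e) % (Literature.Probability.LatticeModels.CollarLegModel.cycle V d₀).length]'(Nat.mod_lt _ (by omega)) = (x₀ + ((e : ℤ) - (R - 2).toNat) • Literature.Probability.LatticeModels.CollarLegModel.dir (k₀ + 1), k₀) :=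
  fun ι V _ hadm h0 _ hs₀ _ _ hds₀ _ _ hd hflat hR e he => cs_run ι V hadm h0 hs₀ hds₀ hd hflat hR e he

end Summit.CriticalPhenomena.CardyFormulaZ2.Cruxes.BoundaryDefectGaussianR.RainbowMonomialsInExcursionKernels
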